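import Mathlib
import HarnessLib
import Summits.Ventures.LatticeQCDFlow.Exactness.SUNEngineWilsonEnergyError
import Summits.Ventures.LatticeQCDFlow.Exactness.GaussianQuadraticEquipartition
import Summits.Ventures.LatticeQCDFlow.Exactness.GaugeFTHMCSymmetricWord
import Summits.Ventures.LatticeQCDFlow.Exactness.WilsonHeatBathErgodic

/-!
# THE MEAN ACCEPTANCE OF THE ENGINE'S `SU(N)` WILSON HMC WITH THE OMF2 INTEGRATOR IS AT LEAST `1 − C·nδ²`, EXPLICITLY, NOTHING ASSUMED

HONEST FRAMING: exact (Metropolis-corrected) sampling algorithms for lattice gauge theory;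
figures of merit are autocorrelation/cost numbers at stated couplings and volumes; no
continuum-physics claim.

Venture `LatticeQCDFlow` (cell pub-lqcd), topic `Exactness`; FANOUT row 14 (`eng-flowhmc`, family B; the engine's
`integrator = "omf2"` on the `SU(N)` rung) serving row 21 (`su3-base`).  The OMF2 twin of `SUNEngineWilsonMeanAcceptance`
(leapfrog).  NEW WORK of the cell: `SUNEngineWilsonEnergyError` (`engine_wilsonHMC_omf2_energy_error_le`: the pointwise
law for the n-step OMF2 proposal `flip ∘ (omf2Word g₁ (mulDrift e_δ) g₂)ⁿ` with the engine's kicks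
`g₁ = −2λδ·F`, `g₂ = −2(1−2λ)δ·F`, `F = sunWilsonForce N β`), `GaussianQuadraticEquipartition` (equipartition moments
`EΣ_e‖p_e‖ ≤ |E|√(D/2)`, `E(Σ_e‖p_e‖)² ≤ |E|²D/2` under the refresh law, `D = N² − 1`), row 9's `GaugeFTHMCSymmetricWord`
(`measurable_flip_omf2Word_pow`; the Borel instances on `Edge d L → SUNCoords N` are supplied locally), row 21's
`SUNWilsonHMCForce`, `WilsonHeatBathErgodic`; nothing is cited as a fact; no number.

* **`engine_wilsonOmf2_meanAcceptance_ge`** — with `F' = 2|δ|F_max`, `γ = (2|λ|+|1−2λ|)F'`, `c₈ = |1−2λ|+2|λ|+1`,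
  `C = (N+4#pairs)(2|δ|K_F)(N²·2N)|δ|`, `b₂ = (n+1)γ`, `c₁ = (n+1)|E|γ`, `c₂ = 4λ²|E|F'`, `M₁ = |E|√(D/2)`,
  `M₂ = |E|²D/2` (`F_max = sunWilsonForceSup N d β`, `K_F = sunWilsonForceLip N d β`): from EVERY configuration `U`,
  `∫ min(1, e^{−ΔH(U,p)}) d(refresh)(p) ≥ 1 − n·C·(c₈M₂ + (c₈(b₂ + c₁) + c₂)M₁ + b₂(c₈c₁ + c₂))` — `C, b₂, c₁, c₂` each
  carry a factor `|δ|`, so the deficit is `O(nδ²)`; every constant explicit, polynomial in `N`, volume entering only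
  through `|E|`;
* **`engine_wilsonOmf2_meanAcceptance_ge_integral`** — the same for the `ν ⊗ refresh` average in ANY probability law `ν`
  of the configuration (e.g. the Wilson measure).

NOT CLAIMED: optimal constants (sup-norm force bounds; the fourth-order advantage of OMF2 is invisible to a Lipschitz
analysis); `L = 1`; floating point; any number.
-/

noncomputable section

namespace Summit.Ventures.LatticeQCDFlow.Exactness

open Set Function MeasureTheory NormedSpace
open Literature.MathematicalPhysics.QuantumFieldTheory
open scoped Matrix Matrix.Norms.Operator ENNReal

set_option backward.isDefEq.respectTransparency false

section MeanAcceptance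

variable (N : ℕ) [NeZero N] (μ : Measure (SUNCoords N)) [μ.IsAddHaarMeasure] {d L : ℕ} [NeZero L]

/-- The engine's `n`-step OMF2 proposal on the `SU(N)` rung is measurable (the Borel structure of
`Edge d L → SUNCoords N` assembled by hand: `Pi.borelSpace` with the product Borel structure of `SUNCoords N`). -/
theorem measurable_engine_wilsonOmf2_proposal (β δ lam : ℝ) (n : ℕ) :
    Measurable (⇑((flip : Equiv.Perm ((Edge d L → Matrix.specialUnitaryGroup (Fin N) ℂ) × (Edge d L → SUNCoords N))) *
          omf2Word ((-(2 * lam * δ)) • sunWilsonForce N (d := d) (L := L) β)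
            (mulDrift (sunExpDrift (sunCoordι N) (sunCoordι_skew N) δ))
            ((-(2 * (1 - 2 * lam) * δ)) • sunWilsonForce N (d := d) (L := L) β) ^ n)) := by
  have hB : ∀ _i : Edge d L, BorelSpace (SUNCoords N) := fun _ => inferInstance
  haveI : BorelSpace (Edge d L → SUNCoords N) := @Pi.borelSpace (Edge d L) (fun _ => SUNCoords N) _ _ _ _ hB
  haveI : MeasurableNeg (Edge d L → SUNCoords N) := ContinuousNeg.measurableNeg
  haveI : MeasurableAdd₂ (Edge d L → SUNCoords N) := ⟨continuous_add.measurable⟩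
  have hgm : ∀ c : ℝ, Measurable (c • sunWilsonForce N β :
      GaugeConfig d L (Matrix.specialUnitaryGroup (Fin N) ℂ) → Edge d L → SUNCoords N) := fun c =>
    measurable_pi_lambda _ fun e =>
      (((continuous_apply e).comp (continuous_sunWilsonForce N β)).const_smul c).measurable
  exact measurable_flip_omf2Word_pow (measurable_sunExpDrift (sunCoordι N) (sunCoordι_skew N) δ) (hgm _) (hgm _) n

set_option maxHeartbeats 400000 in -- RN-23 (7)(b): heavy declaration budgeted at source
/-- **THE MEAN ACCEPTANCE OF THE ENGINE'S `SU(N)` WILSON OMF2-HMC FROM EVERY CONFIGURATION, NOTHING ASSUMED**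
(`N ≥ 1`, torus `L ≥ 2`, every `d`, `β`, `δ`, `λ`, `n`, `U`): with the constants of the docstring,
`∫ min(1, e^{−ΔH(U,p)}) d(sunMomentumLaw μ (sunKinetic N))(p) ≥ 1 − n·C·(c₈M₂ + (c₈(b₂ + c₁) + c₂)M₁ + b₂(c₈c₁ + c₂))`. -/
theorem engine_wilsonOmf2_meanAcceptance_ge (hL : 2 ≤ L) (β δ lam : ℝ)
    (U : GaugeConfig d L (Matrix.specialUnitaryGroup (Fin N) ℂ)) (n : ℕ) :
    1 - n * ((N + 4 * Fintype.card (UpperPair N)) * (2 * |δ| * sunWilsonForceLip N d β) * ((Fintype.card (Fin N) : ℝ) ^ 2 * (2 * N)) * |δ|) *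
        ((|1 - 2 * lam| + 2 * |lam| + 1) * ((Fintype.card (Edge d L) : ℝ) ^ 2 * ((Module.finrank ℝ (SUNCoords N) : ℝ) / 2)) +
          ((|1 - 2 * lam| + 2 * |lam| + 1) * (((n + 1) * ((2 * |lam| + |1 - 2 * lam|) * (2 * |δ| * sunWilsonForceSup N d β))) + ((n + 1) * (Fintype.card (Edge d L) * ((2 * |lam| + |1 - 2 * lam|) * (2 * |δ| * sunWilsonForceSup N d β))))) + (4 * lam ^ 2 * (Fintype.card (Edge d L) * (2 * |δ| * sunWilsonForceSup N d β)))) *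
            (Fintype.card (Edge d L) * Real.sqrt ((Module.finrank ℝ (SUNCoords N) : ℝ) / 2)) +
          ((n + 1) * ((2 * |lam| + |1 - 2 * lam|) * (2 * |δ| * sunWilsonForceSup N d β))) * ((|1 - 2 * lam| + 2 * |lam| + 1) * ((n + 1) * (Fintype.card (Edge d L) * ((2 * |lam| + |1 - 2 * lam|) * (2 * |δ| * sunWilsonForceSup N d β)))) + (4 * lam ^ 2 * (Fintype.card (Edge d L) * (2 * |δ| * sunWilsonForceSup N d β))))) ≤
      ∫ p, min 1 (Real.exp (-((β * wilsonAction (suRep N) (((flip : Equiv.Perm ((Edge d L → Matrix.specialUnitaryGroup (Fin N) ℂ) × (Edge d L → SUNCoords N))) *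
          omf2Word ((-(2 * lam * δ)) • sunWilsonForce N (d := d) (L := L) β)
            (mulDrift (sunExpDrift (sunCoordι N) (sunCoordι_skew N) δ))
            ((-(2 * (1 - 2 * lam) * δ)) • sunWilsonForce N (d := d) (L := L) β) ^ n) (U, p)).1 +
        sunKinetic N (((flip : Equiv.Perm ((Edge d L → Matrix.specialUnitaryGroup (Fin N) ℂ) × (Edge d L → SUNCoords N))) *
          omf2Word ((-(2 * lam * δ)) • sunWilsonForce N (d := d) (L := L) β)
            (mulDrift (sunExpDrift (sunCoordι N) (sunCoordι_skew N) δ))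
            ((-(2 * (1 - 2 * lam) * δ)) • sunWilsonForce N (d := d) (L := L) β) ^ n) (U, p)).2) -
        (β * wilsonAction (suRep N) U + sunKinetic N p))))
        ∂(sunMomentumLaw (L := Edge d L) μ (sunKinetic N)) := by
  haveI := isProbabilityMeasure_sunMomentumLaw_sunKinetic N μ (L := Edge d L)
  -- abbreviations
  set Fm : ℝ := sunWilsonForceSup N d β with hFm
  set C : ℝ := (N + 4 * Fintype.card (UpperPair N)) * (2 * |δ| * sunWilsonForceLip N d β) *
    ((Fintype.card (Fin N) : ℝ) ^ 2 * (2 * N)) * |δ| with hC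
  set γ : ℝ := (2 * |lam| + |1 - 2 * lam|) * (2 * |δ| * Fm) with hγ
  set c₈ : ℝ := |1 - 2 * lam| + 2 * |lam| + 1 with hc₈
  set b₂ : ℝ := (n + 1) * γ with hb₂
  set c₁ : ℝ := (n + 1) * (Fintype.card (Edge d L) * γ) with hc₁
  set c₂ : ℝ := 4 * lam ^ 2 * (Fintype.card (Edge d L) * (2 * |δ| * Fm)) with hc₂
  set α : ℝ := c₈ * (b₂ + c₁) + c₂ with hα
  set κ₀ : ℝ := b₂ * (c₈ * c₁ + c₂) with hκ₀
  set M₁ : ℝ := Fintype.card (Edge d L) * Real.sqrt ((Module.finrank ℝ (SUNCoords N) : ℝ) / 2) with hM₁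
  set M₂ : ℝ := (Fintype.card (Edge d L) : ℝ) ^ 2 * ((Module.finrank ℝ (SUNCoords N) : ℝ) / 2) with hM₂
  have hFm0 : 0 ≤ Fm := by rw [hFm]; exact sunWilsonForceSup_nonneg N d β
  have hK0 : 0 ≤ sunWilsonForceLip N d β := sunWilsonForceLip_nonneg N d β
  have hC0 : 0 ≤ C := by rw [hC]; positivity
  have hγ0 : 0 ≤ γ := by rw [hγ]; positivity
  have hc₈0 : 0 ≤ c₈ := by rw [hc₈]; positivity
  have hb₂0 : 0 ≤ b₂ := by rw [hb₂]; positivity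
  have hc₁0 : 0 ≤ c₁ := by rw [hc₁]; positivity
  have hc₂0 : 0 ≤ c₂ := by rw [hc₂]; positivity
  have hα0 : 0 ≤ α := by rw [hα]; positivity
  set Ψ := ((flip : Equiv.Perm ((Edge d L → Matrix.specialUnitaryGroup (Fin N) ℂ) × (Edge d L → SUNCoords N))) *
          omf2Word ((-(2 * lam * δ)) • sunWilsonForce N (d := d) (L := L) β)
            (mulDrift (sunExpDrift (sunCoordι N) (sunCoordι_skew N) δ))
            ((-(2 * (1 - 2 * lam) * δ)) • sunWilsonForce N (d := d) (L := L) β) ^ n) with hΨ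
  set ΔH : (Edge d L → SUNCoords N) → ℝ := fun p =>
    (β * wilsonAction (suRep N) (Ψ (U, p)).1 + sunKinetic N (Ψ (U, p)).2) - (β * wilsonAction (suRep N) U + sunKinetic N p) with hΔH
  -- `1 − |x| ≤ min(1, e^{−x})`
  have hacc : ∀ x : ℝ, 1 - |x| ≤ min 1 (Real.exp (-x)) := by
    intro x
    rcases le_or_gt x 0 with hx | hx
    · rw [min_eq_left ((Real.one_le_exp_iff).2 (by linarith))]
      linarith [abs_nonneg x]
    · rw [abs_of_pos hx]
      refine le_min (by linarith) ?_
      linarith [Real.add_one_le_exp (-x)]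
  have hsup : ∀ p : Edge d L → SUNCoords N, ‖p‖ ≤ ∑ e, ‖p e‖ := fun p =>
    (pi_norm_le_iff_of_nonneg (Finset.sum_nonneg fun m _ => norm_nonneg (p m))).2 fun e =>
      Finset.single_le_sum (fun m _ => norm_nonneg (p m)) (Finset.mem_univ e)
  -- the pointwise law, as a polynomial in Σ‖p_e‖
  have hpt : ∀ p : Edge d L → SUNCoords N, |ΔH p| ≤ n * C * (c₈ * (∑ e, ‖p e‖) ^ 2 + α * ∑ e, ‖p e‖ + κ₀) := by
    intro p
    have h := engine_wilsonHMC_omf2_energy_error_le N hL β δ lam U p n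
    rw [← hΨ, ← hFm] at h
    have hs := hsup p
    have hs0 : 0 ≤ ∑ e, ‖p e‖ := Finset.sum_nonneg fun e _ => norm_nonneg _
    refine h.trans ?_
    have hQ0 : 0 ≤ c₈ * (∑ e, ‖p e‖ + c₁) + c₂ := by positivity
    calc (n : ℝ) * ((N + 4 * Fintype.card (UpperPair N)) * (2 * |δ| * sunWilsonForceLip N d β) *
          ((Fintype.card (Fin N) : ℝ) ^ 2 * (2 * N)) * |δ| * (‖p‖ + (n + 1) * ((2 * |lam| + |1 - 2 * lam|) * (2 * |δ| * Fm))) *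
          ((|1 - 2 * lam| + 2 * |lam| + 1) * (∑ e, ‖p e‖ + (n + 1) * (Fintype.card (Edge d L) * ((2 * |lam| + |1 - 2 * lam|) * (2 * |δ| * Fm)))) +
            4 * lam ^ 2 * (Fintype.card (Edge d L) * (2 * |δ| * Fm))))
        = n * (C * (‖p‖ + b₂)) * (c₈ * (∑ e, ‖p e‖ + c₁) + c₂) := by
          rw [hC, hb₂, hc₁, hc₂, hc₈, hγ]; ring
      _ ≤ n * (C * (∑ e, ‖p e‖ + b₂)) * (c₈ * (∑ e, ‖p e‖ + c₁) + c₂) := by gcongr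
      _ = n * C * (c₈ * (∑ e, ‖p e‖) ^ 2 + α * ∑ e, ‖p e‖ + κ₀) := by
          rw [hα, hκ₀]; ring
  -- measurability of ΔH and integrability of both sides
  have hS : Measurable fun W : GaugeConfig d L (Matrix.specialUnitaryGroup (Fin N) ℂ) => β * wilsonAction (suRep N) W :=
    (continuous_smul_wilsonAction (suRep N) continuous_suRep β).measurable
  have hΨm : Measurable (⇑Ψ) := by
    rw [hΨ]; exact measurable_engine_wilsonOmf2_proposal N β δ lam n
  have hT : Measurable (sunKinetic (L := Edge d L) N) := measurable_sunKinetic N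
  have hΔm : Measurable ΔH := by
    rw [hΔH]
    have hq : Measurable fun p : Edge d L → SUNCoords N => Ψ (U, p) := hΨm.comp measurable_prodMk_left
    exact ((hS.comp (measurable_fst.comp hq)).add (hT.comp (measurable_snd.comp hq))).sub (measurable_const.add hT)
  have hacc_int : Integrable (fun p => min 1 (Real.exp (-ΔH p))) (sunMomentumLaw (L := Edge d L) μ (sunKinetic N)) := by
    refine (integrable_const (1 : ℝ)).mono' (measurable_const.min (hΔm.neg.exp)).aestronglyMeasurable
      (Filter.Eventually.of_forall fun p => ?_)
    rw [Real.norm_eq_abs, abs_of_nonneg (le_min zero_le_one (Real.exp_pos _).le)]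
    exact min_le_left _ _
  have hint1 : Integrable (fun p : Edge d L → SUNCoords N => ∑ e, ‖p e‖) (sunMomentumLaw (L := Edge d L) μ (sunKinetic N)) :=
    integrable_finsetSum _ fun e _ => integrable_norm_apply_sunKineticLaw N μ e
  have hint2 : Integrable (fun p : Edge d L → SUNCoords N => (∑ e, ‖p e‖) ^ 2) (sunMomentumLaw (L := Edge d L) μ (sunKinetic N)) :=
    integrable_sq_sum_norm_sunKineticLaw N μ
  have hc8s : Integrable (fun p : Edge d L → SUNCoords N => c₈ * (∑ e, ‖p e‖) ^ 2) (sunMomentumLaw (L := Edge d L) μ (sunKinetic N)) :=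
    hint2.const_mul c₈
  have hαs : Integrable (fun p : Edge d L → SUNCoords N => α * ∑ e, ‖p e‖) (sunMomentumLaw (L := Edge d L) μ (sunKinetic N)) :=
    hint1.const_mul α
  have h2α : Integrable (fun p : Edge d L → SUNCoords N => c₈ * (∑ e, ‖p e‖) ^ 2 + α * ∑ e, ‖p e‖)
      (sunMomentumLaw (L := Edge d L) μ (sunKinetic N)) := hc8s.add hαs
  have hq3 : Integrable (fun p : Edge d L → SUNCoords N => c₈ * (∑ e, ‖p e‖) ^ 2 + α * ∑ e, ‖p e‖ + κ₀)
      (sunMomentumLaw (L := Edge d L) μ (sunKinetic N)) := h2α.add (integrable_const _)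
  have hCq : Integrable (fun p : Edge d L → SUNCoords N => n * C * (c₈ * (∑ e, ‖p e‖) ^ 2 + α * ∑ e, ‖p e‖ + κ₀))
      (sunMomentumLaw (L := Edge d L) μ (sunKinetic N)) := hq3.const_mul _
  have hpoly_int : Integrable (fun p : Edge d L → SUNCoords N => 1 - n * C * (c₈ * (∑ e, ‖p e‖) ^ 2 + α * ∑ e, ‖p e‖ + κ₀))
      (sunMomentumLaw (L := Edge d L) μ (sunKinetic N)) := (integrable_const _).sub hCq
  -- integrate the pointwise bound
  have hmono : ∫ p, (1 - n * C * (c₈ * (∑ e, ‖p e‖) ^ 2 + α * ∑ e, ‖p e‖ + κ₀))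
        ∂(sunMomentumLaw (L := Edge d L) μ (sunKinetic N)) ≤
      ∫ p, min 1 (Real.exp (-ΔH p)) ∂(sunMomentumLaw (L := Edge d L) μ (sunKinetic N)) :=
    integral_mono hpoly_int hacc_int fun p => ((sub_le_sub_left (hpt p) 1).trans (hacc (ΔH p)))
  have hlhs : ∫ p, (1 - n * C * (c₈ * (∑ e, ‖p e‖) ^ 2 + α * ∑ e, ‖p e‖ + κ₀))
        ∂(sunMomentumLaw (L := Edge d L) μ (sunKinetic N)) =
      1 - n * C * (c₈ * ∫ p, (∑ e, ‖p e‖) ^ 2 ∂(sunMomentumLaw (L := Edge d L) μ (sunKinetic N)) +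
        α * ∫ p, ∑ e, ‖p e‖ ∂(sunMomentumLaw (L := Edge d L) μ (sunKinetic N)) + κ₀) := by
    rw [integral_sub (integrable_const _) hCq, integral_const, integral_const_mul, integral_add h2α (integrable_const _),
      integral_add hc8s hαs, integral_const_mul, integral_const_mul, integral_const]
    simp only [probReal_univ, smul_eq_mul, one_mul]
  have hE2 : ∫ p, (∑ e, ‖p e‖) ^ 2 ∂(sunMomentumLaw (L := Edge d L) μ (sunKinetic N)) ≤ M₂ := by
    rw [hM₂]; exact integral_sq_sum_norm_sunKineticLaw_le_half_finrank N μ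
  have hE1 : ∫ p, ∑ e, ‖p e‖ ∂(sunMomentumLaw (L := Edge d L) μ (sunKinetic N)) ≤ M₁ := by
    rw [hM₁]; exact integral_sum_norm_sunKineticLaw_le_sqrt N μ
  have hfin : 1 - n * C * (c₈ * M₂ + α * M₁ + κ₀) ≤
      1 - n * C * (c₈ * ∫ p, (∑ e, ‖p e‖) ^ 2 ∂(sunMomentumLaw (L := Edge d L) μ (sunKinetic N)) +
        α * ∫ p, ∑ e, ‖p e‖ ∂(sunMomentumLaw (L := Edge d L) μ (sunKinetic N)) + κ₀) := by
    have hcoef : 0 ≤ (n : ℝ) * C := by positivity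
    have h1 := mul_le_mul_of_nonneg_left hE1 hα0
    have h2 := mul_le_mul_of_nonneg_left hE2 hc₈0
    have h3 : (n : ℝ) * C * (c₈ * ∫ p, (∑ e, ‖p e‖) ^ 2 ∂(sunMomentumLaw (L := Edge d L) μ (sunKinetic N)) +
        α * ∫ p, ∑ e, ‖p e‖ ∂(sunMomentumLaw (L := Edge d L) μ (sunKinetic N)) + κ₀) ≤
        n * C * (c₈ * M₂ + α * M₁ + κ₀) := mul_le_mul_of_nonneg_left (by linarith) hcoef
    linarith
  have hgoal := (hfin.trans (hlhs.symm.le)).trans hmono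
  rw [hα, hκ₀, hb₂, hc₁, hc₂, hc₈, hγ, hC, hM₁, hM₂, hFm] at hgoal
  simpa only [hΔH, hΨ] using hgoal

set_option maxHeartbeats 400000 in -- RN-23 (7)(b): heavy declaration budgeted at source
/-- **… and in ANY law of the configuration** (e.g. the Wilson measure): the `ν ⊗ refresh`-averaged Metropolis
acceptance of the engine's `SU(N)` Wilson OMF2-HMC obeys the same bound. -/
theorem engine_wilsonOmf2_meanAcceptance_ge_integral (hL : 2 ≤ L) (β δ lam : ℝ) (n : ℕ)
    (ν : Measure (GaugeConfig d L (Matrix.specialUnitaryGroup (Fin N) ℂ))) [IsProbabilityMeasure ν] :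
    1 - n * ((N + 4 * Fintype.card (UpperPair N)) * (2 * |δ| * sunWilsonForceLip N d β) * ((Fintype.card (Fin N) : ℝ) ^ 2 * (2 * N)) * |δ|) *
        ((|1 - 2 * lam| + 2 * |lam| + 1) * ((Fintype.card (Edge d L) : ℝ) ^ 2 * ((Module.finrank ℝ (SUNCoords N) : ℝ) / 2)) +
          ((|1 - 2 * lam| + 2 * |lam| + 1) * (((n + 1) * ((2 * |lam| + |1 - 2 * lam|) * (2 * |δ| * sunWilsonForceSup N d β))) + ((n + 1) * (Fintype.card (Edge d L) * ((2 * |lam| + |1 - 2 * lam|) * (2 * |δ| * sunWilsonForceSup N d β))))) + (4 * lam ^ 2 * (Fintype.card (Edge d L) * (2 * |δ| * sunWilsonForceSup N d β)))) *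
            (Fintype.card (Edge d L) * Real.sqrt ((Module.finrank ℝ (SUNCoords N) : ℝ) / 2)) +
          ((n + 1) * ((2 * |lam| + |1 - 2 * lam|) * (2 * |δ| * sunWilsonForceSup N d β))) * ((|1 - 2 * lam| + 2 * |lam| + 1) * ((n + 1) * (Fintype.card (Edge d L) * ((2 * |lam| + |1 - 2 * lam|) * (2 * |δ| * sunWilsonForceSup N d β)))) + (4 * lam ^ 2 * (Fintype.card (Edge d L) * (2 * |δ| * sunWilsonForceSup N d β))))) ≤
      ∫ U, ∫ p, min 1 (Real.exp (-((β * wilsonAction (suRep N) (((flip : Equiv.Perm ((Edge d L → Matrix.specialUnitaryGroup (Fin N) ℂ) × (Edge d L → SUNCoords N))) *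
          omf2Word ((-(2 * lam * δ)) • sunWilsonForce N (d := d) (L := L) β)
            (mulDrift (sunExpDrift (sunCoordι N) (sunCoordι_skew N) δ))
            ((-(2 * (1 - 2 * lam) * δ)) • sunWilsonForce N (d := d) (L := L) β) ^ n) (U, p)).1 +
        sunKinetic N (((flip : Equiv.Perm ((Edge d L → Matrix.specialUnitaryGroup (Fin N) ℂ) × (Edge d L → SUNCoords N))) *
          omf2Word ((-(2 * lam * δ)) • sunWilsonForce N (d := d) (L := L) β)
            (mulDrift (sunExpDrift (sunCoordι N) (sunCoordι_skew N) δ))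
            ((-(2 * (1 - 2 * lam) * δ)) • sunWilsonForce N (d := d) (L := L) β) ^ n) (U, p)).2) -
        (β * wilsonAction (suRep N) U + sunKinetic N p))))
        ∂(sunMomentumLaw (L := Edge d L) μ (sunKinetic N)) ∂ν := by
  haveI := isProbabilityMeasure_sunMomentumLaw_sunKinetic N μ (L := Edge d L)
  have hpt := fun U : GaugeConfig d L (Matrix.specialUnitaryGroup (Fin N) ℂ) =>
    engine_wilsonOmf2_meanAcceptance_ge N μ hL β δ lam U n
  set Ψ := ((flip : Equiv.Perm ((Edge d L → Matrix.specialUnitaryGroup (Fin N) ℂ) × (Edge d L → SUNCoords N))) *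
          omf2Word ((-(2 * lam * δ)) • sunWilsonForce N (d := d) (L := L) β)
            (mulDrift (sunExpDrift (sunCoordι N) (sunCoordι_skew N) δ))
            ((-(2 * (1 - 2 * lam) * δ)) • sunWilsonForce N (d := d) (L := L) β) ^ n) with hΨ
  have hS : Measurable fun W : GaugeConfig d L (Matrix.specialUnitaryGroup (Fin N) ℂ) => β * wilsonAction (suRep N) W :=
    (continuous_smul_wilsonAction (suRep N) continuous_suRep β).measurable
  have hΨm : Measurable (⇑Ψ) := by
    rw [hΨ]; exact measurable_engine_wilsonOmf2_proposal N β δ lam n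
  have hT : Measurable (sunKinetic (L := Edge d L) N) := measurable_sunKinetic N
  have hjoint : Measurable fun z : GaugeConfig d L (Matrix.specialUnitaryGroup (Fin N) ℂ) × (Edge d L → SUNCoords N) =>
      min 1 (Real.exp (-((β * wilsonAction (suRep N) (Ψ z).1 + sunKinetic N (Ψ z).2) -
        (β * wilsonAction (suRep N) z.1 + sunKinetic N z.2)))) :=
    measurable_const.min ((((hS.comp (measurable_fst.comp hΨm)).add (hT.comp (measurable_snd.comp hΨm))).sub
      ((hS.comp measurable_fst).add (hT.comp measurable_snd))).neg.exp)
  have hF : Integrable (fun U : GaugeConfig d L (Matrix.specialUnitaryGroup (Fin N) ℂ) => ∫ p, min 1 (Real.exp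
      (-((β * wilsonAction (suRep N) (Ψ (U, p)).1 + sunKinetic N (Ψ (U, p)).2) - (β * wilsonAction (suRep N) U + sunKinetic N p))))
        ∂(sunMomentumLaw (L := Edge d L) μ (sunKinetic N))) ν := by
    refine (integrable_const (1 : ℝ)).mono' (hjoint.stronglyMeasurable.integral_prod_right'
      (ν := sunMomentumLaw (L := Edge d L) μ (sunKinetic N))).aestronglyMeasurable (Filter.Eventually.of_forall fun U => ?_)
    refine (norm_integral_le_of_norm_le_const (C := 1) (Filter.Eventually.of_forall fun p => ?_)).trans ?_
    · rw [Real.norm_eq_abs, abs_of_nonneg (le_min zero_le_one (Real.exp_pos _).le)]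
      exact min_le_left _ _
    · rw [probReal_univ, mul_one]
  calc _ = ∫ _U : GaugeConfig d L (Matrix.specialUnitaryGroup (Fin N) ℂ), (1 - n * ((N + 4 * Fintype.card (UpperPair N)) * (2 * |δ| * sunWilsonForceLip N d β) * ((Fintype.card (Fin N) : ℝ) ^ 2 * (2 * N)) * |δ|) *
        ((|1 - 2 * lam| + 2 * |lam| + 1) * ((Fintype.card (Edge d L) : ℝ) ^ 2 * ((Module.finrank ℝ (SUNCoords N) : ℝ) / 2)) +
          ((|1 - 2 * lam| + 2 * |lam| + 1) * (((n + 1) * ((2 * |lam| + |1 - 2 * lam|) * (2 * |δ| * sunWilsonForceSup N d β))) + ((n + 1) * (Fintype.card (Edge d L) * ((2 * |lam| + |1 - 2 * lam|) * (2 * |δ| * sunWilsonForceSup N d β))))) + (4 * lam ^ 2 * (Fintype.card (Edge d L) * (2 * |δ| * sunWilsonForceSup N d β)))) *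
            (Fintype.card (Edge d L) * Real.sqrt ((Module.finrank ℝ (SUNCoords N) : ℝ) / 2)) +
          ((n + 1) * ((2 * |lam| + |1 - 2 * lam|) * (2 * |δ| * sunWilsonForceSup N d β))) * ((|1 - 2 * lam| + 2 * |lam| + 1) * ((n + 1) * (Fintype.card (Edge d L) * ((2 * |lam| + |1 - 2 * lam|) * (2 * |δ| * sunWilsonForceSup N d β)))) + (4 * lam ^ 2 * (Fintype.card (Edge d L) * (2 * |δ| * sunWilsonForceSup N d β)))))) ∂ν := by
          rw [integral_const, probReal_univ, one_smul]
    _ ≤ _ := integral_mono (integrable_const _) hF hpt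

end MeanAcceptance

end Summit.Ventures.LatticeQCDFlow.Exactness
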